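import Literature.AlgebraicGeometry.Resolution.PrimeDivisorIdeals
import Literature.AlgebraicGeometry.Resolution.StalkIdealGenerization
import Literature.AlgebraicGeometry.Resolution.RsopMonomialIdeals
import Literature.AlgebraicGeometry.Resolution.SncStrata
import Literature.AlgebraicGeometry.Resolution.DivisorialPart
import HarnessLib

/-!
# Crux `PatchingRelPerfect` (stmt-ResolutionOfSingularities-16161), chain W5.2 — T6-E1b residual `LegalScopedDivisorReduction₃`,
# PHASE 2 closer (2b), spec §D4 ORACLE PLAN, sub-lemmas L5/L6: FACTORISATION OF A TRACE GERM ALONG THE BOUNDARY BRANCHES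

[OURS · L1 W5.2 · res-L1-w52-lead-1 g6, hand #3b; spec `L/res-L1-w52-lead-1/PHASE2-STEPB-SPEC.md` §D4 ORACLE PLAN L5/L6] Replaces the
role of NO printed item; NOT a statement of the manuscript under review; fact-free.

The local algebra the curve-choosing ORACLE (`DepthLegal.CurveOracle`, …DepthLegalLoop) needs at a point `x` of the host surface `X`:
the STEP A invariant says that the support of the trace `T = M|_X` of the boundary lies in a strict normal crossings divisor `B_X` of
`X`; if `v₁, …, v_d` is a regular system of parameters of `𝒪_{X,x}` in which every component of `B_X` through `x` is a coordinate
hyperplane `(v_{lab G})`, then every germ `f` whose zero locus (near `x`, i.e. on the generisations of `x`) lies in `B_X` is a MONOMIAL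
in the labelled coordinates: `f = unit · ∏ v_i ^ {k_i}` with `k_i = 0` off the labels.

* `IsRsopPart.exists_eq_unit_mul_prod_pow` (L5, ring level) — in a regular local ring (factorial by Auslander–Buchsbaum), an element
  all of whose prime factors divide members `z_i`, `i ∈ S`, of a part of a regular system of parameters is `unit · ∏_{i} z_i^{k_i}` with
  `k` supported in `S` (the `z_i` are pairwise non-associated primes).
* `IsRsopPart.dvd_unit_mul_prod_pow_iff` — `z_i ∣ unit · ∏ z_j^{k_j} ↔ k_i ≠ 0`.
* `exists_germ_eq_unit_mul_prod_pow` (L6, scheme level) — the statement of the first paragraph, the prime factors being read off through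
  the generisations `X.fromSpecStalk x 𝔮` (Stacks 01J7) and `ζ ∈ Supp 𝓘 ↔ 𝓘_x ≤ 𝔭_ζ`.
* `mem_support_iff_dvd_of_primeOfSpecializes_eq` — along `ζ ⤳ x` with `𝔭_ζ = (v)`: `ζ ∈ Supp 𝓘 ↔ v ∣ f` for `𝓘_x = (f)`.
* `exists_specializes_mem_divisorialPoints` — a point of the support of an ideal sheaf with non-zero principal stalk `(g)` in a Noetherian
  domain `𝒪_{X,x}` lies under a CODIMENSION-ONE point of the support (Krull's Hauptidealsatz): the oracle's supply of candidate curves.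

AI-written; AI review is weaker than expert review.

## References
* H. Matsumura, *Commutative Ring Theory* (1986), Thm. 14.2, Thm. 14.3, Thm. 20.3. [Matsumura1987]
* The Stacks Project, Tags 01J7, 00KV, 02IZ. [StacksProject]
-/

-- `Summit.<Summit>.<Sub>.Theorems` with `Sub = Summit` (single-conjunct summit, D-0017)
set_option linter.dupNamespace false

noncomputable section

open CategoryTheory CategoryTheory.Limits AlgebraicGeometry TopologicalSpace IsLocalRing
open Literature.AlgebraicGeometry.Resolution Scheme.IdealSheafData

namespace Summit.ResolutionOfSingularities.ResolutionOfSingularities.Theorems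

universe u

namespace DepthLegal

/-! ## §1 Ring level (L5): monomial factorisation along a part of a regular system of parameters -/

section Ring

variable {R : Type*} [CommRing R] [IsLocalRing R] {n : ℕ} {z : Fin n → R}

/-- [OURS · L1 W5.2] **L5.** In a regular local ring let `z` be part of a regular system of parameters and `f ≠ 0` an element every
prime factor of which divides some `z_i` with `i ∈ S`. Then `f = c · ∏_i z_i^{k_i}` with `c` a unit and `k` supported in `S`
(`𝒪` is factorial, Auslander–Buchsbaum; the `z_i` are prime). [cite: Matsumura1987, Thm. 20.3] [cite: Matsumura1987, Thm. 14.3] -/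
theorem _root_.Literature.AlgebraicGeometry.Resolution.IsRsopPart.exists_eq_unit_mul_prod_pow (hz : IsRsopPart z)
    {f : R} (hf : f ≠ 0) (S : Set (Fin n)) (h : ∀ p : R, Prime p → p ∣ f → ∃ i ∈ S, p ∣ z i) :
    ∃ (c : R) (k : Fin n → ℕ), IsUnit c ∧ f = c * ∏ i, z i ^ k i ∧ ∀ i, k i ≠ 0 → i ∈ S := by
  classical
  haveI := hz.isRegularLocalRing
  haveI := isDomain_of_isRegularLocalRing R
  haveI := IsRegularLocalRing.uniqueFactorizationMonoid R
  -- induction over the prime factorisation of `f`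
  suffices H : ∀ g : R, g ≠ 0 → (∀ p : R, Prime p → p ∣ g → ∃ i ∈ S, p ∣ z i) →
      ∃ (c : R) (k : Fin n → ℕ), IsUnit c ∧ g = c * ∏ i, z i ^ k i ∧ ∀ i, k i ≠ 0 → i ∈ S from H f hf h
  intro g
  induction g using UniqueFactorizationMonoid.induction_on_prime with
  | h₁ => intro h0; exact absurd rfl h0
  | h₂ u hu => intro _ _; exact ⟨u, 0, hu, by simp, fun i hi => absurd rfl hi⟩
  | h₃ a p ha hp ih =>
    intro _ hdiv
    obtain ⟨i, hiS, hi⟩ := hdiv p hp (dvd_mul_right p a)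
    -- `p ∣ z i` with `z i` prime: `p` is a unit multiple of `z i`
    have hassoc : Associated p (z i) := hp.irreducible.associated_of_dvd (hz.prime i).irreducible hi
    obtain ⟨u, hu⟩ := hassoc
    obtain ⟨c, k, hc, hak, hkS⟩ := ih ha fun q hq hqa => hdiv q hq (hqa.mul_left p)
    refine ⟨c * ↑u⁻¹, fun j => if j = i then k j + 1 else k j, hc.mul (Units.isUnit _), ?_, ?_⟩
    · have hp' : p = z i * ↑u⁻¹ := by rw [← hu, mul_assoc, Units.mul_inv, mul_one]
      have hprod : (∏ j, z j ^ (if j = i then k j + 1 else k j)) = (∏ j, z j ^ k j) * z i := by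
        rw [← Finset.prod_mul_prod_compl ({i} : Finset (Fin n)), ← Finset.prod_mul_prod_compl ({i} : Finset (Fin n))
          (f := fun j => z j ^ k j), Finset.prod_singleton, Finset.prod_singleton, if_pos rfl, pow_succ]
        have hc' : ∏ j ∈ ({i} : Finset (Fin n))ᶜ, z j ^ (if j = i then k j + 1 else k j) = ∏ j ∈ ({i} : Finset (Fin n))ᶜ, z j ^ k j :=
          Finset.prod_congr rfl fun j hj => by
            rw [Finset.mem_compl, Finset.mem_singleton] at hj
            rw [if_neg hj]
        rw [hc']
        ring
      rw [hprod, hak, hp']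
      ring
    · intro j hj
      by_cases hji : j = i
      · exact hji ▸ hiS
      · simp only [if_neg hji] at hj
        exact hkS j hj

/-- [OURS · L1 W5.2] **Exponents are read off by divisibility**: `z_i ∣ c · ∏_j z_j^{k_j}` iff `k_i ≠ 0` (distinct members of a part of a
regular system of parameters are non-associated primes). [cite: Matsumura1987, Thm. 14.3] -/
theorem _root_.Literature.AlgebraicGeometry.Resolution.IsRsopPart.dvd_unit_mul_prod_pow_iff (hz : IsRsopPart z) {c : R}
    (hc : IsUnit c) (k : Fin n → ℕ) (i : Fin n) : z i ∣ c * ∏ j, z j ^ k j ↔ k i ≠ 0 := by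
  classical
  haveI := hz.isRegularLocalRing
  haveI := isDomain_of_isRegularLocalRing R
  constructor
  · intro hdvd hki
    have h1 : z i ∣ ∏ j, z j ^ k j := (hc.dvd_mul_left).mp hdvd
    obtain ⟨j, -, hj⟩ := (hz.prime i).exists_mem_finset_dvd h1
    have hij : i ≠ j := by rintro rfl; rw [hki, pow_zero] at hj; exact (hz.prime i).not_unit (isUnit_of_dvd_one hj)
    exact hz.not_dvd hij ((hz.prime i).dvd_of_dvd_pow hj)
  · intro hki
    have h1 : z i ∣ ∏ j, z j ^ k j := (dvd_pow_self (z i) hki).trans (Finset.dvd_prod_of_mem _ (Finset.mem_univ i))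
    exact h1.mul_left c

end Ring

/-! ## §2 Scheme level (L6): the germ of an ideal sheaf supported in a labelled normal crossings divisor -/

section SchemeLevel

variable {X : Scheme.{u}} {x : X}

/-- [OURS · L1 W5.2] **Supports along a generisation, principal form**: for `ζ ⤳ x` with `𝔭_ζ = (v)` and `𝓘_x = (f)`,
`ζ ∈ Supp 𝓘 ↔ v ∣ f`. [cite: StacksProject, Tag 01J7] -/
theorem mem_support_iff_dvd_of_primeOfSpecializes_eq {ζ : X} (h : ζ ⤳ x) {v f : X.presheaf.stalk x}
    (hv : primeOfSpecializes h = Ideal.span {v}) (I : X.IdealSheafData) (hf : stalkIdeal I x = Ideal.span {f}) :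
    ζ ∈ I.support ↔ v ∣ f := by
  rw [mem_support_iff_stalkIdeal_le_primeOfSpecializes h, hv, hf, Ideal.span_singleton_le_span_singleton]

/-- [OURS · L1 W5.2] **L6. A germ supported in a labelled normal crossings divisor is a monomial in the labelled coordinates.**
Let `v : Fin d → 𝒪_{X,x}` be part of a regular system of parameters, `𝓔` a list of ideal sheaves each member `G` of which through
`x` has stalk `(v_{lab G})`, and `𝓘` an ideal sheaf with `𝓘_x = (f)`, `f ≠ 0`, such that every generisation of `x` in `Supp 𝓘` lies in
the support of a member of `𝓔`. Then `f = c · ∏_i v_i^{k_i}` with `c` a unit and `k_i = 0` unless `i` is a label. (Every prime factor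
`p` of `f` is the prime `𝔭_η` of the generisation `η = fromSpecStalk x (p)`, which lies in `Supp 𝓘`, hence in some `Supp G`, so
`(v_{lab G}) ≤ (p)`.) [cite: StacksProject, Tag 01J7] [cite: Matsumura1987, Thm. 20.3] -/
theorem exists_germ_eq_unit_mul_prod_pow {d : ℕ} {v : Fin d → X.presheaf.stalk x} (hv : IsRsopPart v)
    (𝓔 : List X.IdealSheafData) (lab : {G : X.IdealSheafData // G ∈ 𝓔 ∧ x ∈ G.support} → Fin d)
    (hlab : ∀ G, stalkIdeal G.1 x = Ideal.span {v (lab G)})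
    (I : X.IdealSheafData) {f : X.presheaf.stalk x} (hf : stalkIdeal I x = Ideal.span {f}) (hf0 : f ≠ 0)
    (hsupp : ∀ η : X, η ⤳ x → η ∈ I.support → ∃ G ∈ 𝓔, η ∈ G.support) :
    ∃ (c : X.presheaf.stalk x) (k : Fin d → ℕ), IsUnit c ∧ f = c * ∏ i, v i ^ k i ∧
      ∀ i, k i ≠ 0 → ∃ G, lab G = i := by
  refine hv.exists_eq_unit_mul_prod_pow hf0 {i | ∃ G, lab G = i} fun p hp hpf => ?_
  -- the generisation defined by the prime `(p)`
  haveI : (Ideal.span {p}).IsPrime := (Ideal.span_singleton_prime hp.ne_zero).mpr hp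
  let 𝔮 : PrimeSpectrum (X.presheaf.stalk x) := ⟨Ideal.span {p}, inferInstance⟩
  have hη : X.fromSpecStalk x 𝔮 ⤳ x := fromSpecStalk_specializes 𝔮
  have h𝔭 : primeOfSpecializes hη = Ideal.span {p} := primeOfSpecializes_fromSpecStalk 𝔮
  have hηI : X.fromSpecStalk x 𝔮 ∈ I.support := (mem_support_iff_dvd_of_primeOfSpecializes_eq hη h𝔭 I hf).mpr hpf
  obtain ⟨G, hG, hηG⟩ := hsupp _ hη hηI
  have hxG : x ∈ G.support := hη.mem_closed G.support.isClosed hηG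
  refine ⟨lab ⟨G, hG, hxG⟩, ⟨_, rfl⟩, ?_⟩
  exact (mem_support_iff_dvd_of_primeOfSpecializes_eq hη h𝔭 G (hlab ⟨G, hG, hxG⟩)).mp hηG

end SchemeLevel

/-! ## §3 Supply of candidate curves: a codimension-one point of the support under any point of it -/

section Supply

variable {X : Scheme.{u}}

/-- [OURS · L1 W5.2] **Krull's Hauptidealsatz on a scheme.** If the stalk `𝓘_x = (g)` at a point `x ∈ Supp 𝓘` is principal and non-zero
in the Noetherian domain `𝒪_{X,x}`, then some codimension-one point `ζ` of `Supp 𝓘` specialises to `x`: take a height-one prime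
`P ∋ g` (Stacks 00KV) and `ζ = fromSpecStalk x P`, whose coheight is `ht 𝔭_ζ = ht P = 1` (Stacks 02IZ).
[cite: StacksProject, Tag 00KV] [cite: StacksProject, Tag 02IZ] -/
theorem exists_specializes_mem_divisorialPoints (I : X.IdealSheafData) {x : X} [IsDomain (X.presheaf.stalk x)]
    [IsNoetherianRing (X.presheaf.stalk x)] {g : X.presheaf.stalk x} (hg : stalkIdeal I x = Ideal.span {g}) (hg0 : g ≠ 0)
    (hx : x ∈ I.support) : ∃ ζ : X, ζ ⤳ x ∧ ζ ∈ divisorialPoints I := by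
  have hgm : g ∈ maximalIdeal (X.presheaf.stalk x) :=
    (Ideal.span_singleton_le_iff_mem _).mp (hg ▸ (mem_support_iff_stalkIdeal_le I x).mp hx)
  obtain ⟨P, hP, hP1, hgP⟩ := Ideal.exists_height_eq_one_of_mem_nonunits hg0 hgm
  let 𝔮 : PrimeSpectrum (X.presheaf.stalk x) := ⟨P, hP⟩
  have hη : X.fromSpecStalk x 𝔮 ⤳ x := fromSpecStalk_specializes 𝔮
  have h𝔭 : primeOfSpecializes hη = P := primeOfSpecializes_fromSpecStalk 𝔮
  refine ⟨X.fromSpecStalk x 𝔮, hη, ?_, ?_⟩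
  · rw [mem_support_iff_stalkIdeal_le_primeOfSpecializes hη, h𝔭, hg, Ideal.span_singleton_le_iff_mem]
    exact hgP
  · have h1 := coe_height_primeOfSpecializes hη
    rw [h𝔭, hP1] at h1
    exact_mod_cast h1.symm

end Supply

end DepthLegal

end Summit.ResolutionOfSingularities.ResolutionOfSingularities.Theorems

end
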